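import Summits.Ventures.HodgeRepro2.T5SU11KernelCompositionTransformAbs
import Summits.Ventures.HodgeRepro2.T5SU11KernelDiagonalDerivative
import Summits.Ventures.HodgeRepro2.T5SU11KernelDiagonalAsymptotic

/-!
# Summary XXVIII — exact norms, the semi-separable structure and the diagonal of the kernel (rows 619–622), under uniform names

Throughout `μ = λ(λ − 2)`, `K_λ` the kernel of `G^I_λ`, `K_λ^{∘(k+1)}(t, s) = (G^I_λ)ᵏ K_λ(·, s)(t)` the composed kernels, `Ξ = φ_1`
the ground state, `T_λ` the tail integral `∫_t^∞ ds/(sinh 2s φ_λ(a_s)²)`.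

* `kernel_comp_abs_transform`, `kernel_abs_transform` — **`∫ |K_λ^{∘(k+1)}(t, s)| Ξ(t) sinh 2t dt = Ξ(s)/((λ − 1)²)^{k+1}`** (row 619);
* `kernel_semi_separable`, `kernel_diagonal_formula`, `tail_antitone`, `kernel_geometric_mean`, `kernel_geometric_mean_sqrt` —
  **the rank-one identity, `K_λ(t, t) = −φ_λ² T_λ`, and `|K_λ(t, s)| ≤ √(|K_λ(t, t)| |K_λ(s, s)|)`** (row 620);
* `kernel_row_sq_integral`, `kernel_row_sq_integrable`, `kernel_diagonal_deriv`, `kernel_row_sq_pos` —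
  **`∫ K_λ(t, r)² sinh 2r dr = (K ∘ K)(t, t) = ∂_μ K_μ(t, t) > 0`** (row 621);
* `kernel_diagonal_sinh_limit`, `kernel_diagonal_limit`, `resolvent_not_trace_class` —
  **`K_λ(t, t) sinh 2t → −1/(2(λ − 1))`, `K_λ(t, t) → 0`, and the diagonal is not integrable against `sinh 2t dt`** (row 622).

Nothing is claimed about (N).

Blind lane: Mathlib + the HodgeRepro2 prefix only; no sorry; axioms ⊆ {propext, Classical.choice,
Quot.sound}.
-/

namespace Summit.Ventures.HodgeRepro2.T5SU11RadialSummaryXXVIII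

open Filter Topology MeasureTheory
open Set (Ioi Ioc)
open T5SU11Cartan T5SU11SphericalFunction T5SU11SphericalDecay T5SU11ReductionOfOrderInfinity T5SU11RadialGreenKernel
  T5SU11RadialGreenImproper T5SU11KernelCompositionTransformAbs T5SU11KernelSemiSeparable T5SU11KernelDiagonalDerivative
  T5SU11KernelDiagonalAsymptotic

section measure

variable [MeasurableSpace Circle] [BorelSpace Circle]

variable {lam : ℝ} (hlam : 1 < lam)

include hlam in
/-- **`∫ |K_λ^{∘(k+1)}(t, s)| Ξ(t) sinh 2t dt = Ξ(s)/((λ − 1)²)^{k+1}`** (row 619). -/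
theorem kernel_comp_abs_transform {s : ℝ} (hs : 0 < s) (k : ℕ) :
    ∫ t in Ioi 0, |((greenSolI (fun t => sph lam (hyp t)) (sphDecay lam))^[k] (fun r => sphGreenKernel lam r s)) t|
        * sph 1 (hyp t) * Real.sinh (2 * t)
      = sph 1 (hyp s) / ((lam - 1) ^ 2) ^ (k + 1) :=
  integral_abs_kernel_comp_mul_sph_one hlam hs k

include hlam in
/-- **`∫ |K_λ(t, s)| Ξ(t) sinh 2t dt = Ξ(s)/(λ − 1)²`** (row 619). -/
theorem kernel_abs_transform {s : ℝ} (hs : 0 < s) :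
    ∫ t in Ioi 0, |sphGreenKernel lam t s| * sph 1 (hyp t) * Real.sinh (2 * t) = sph 1 (hyp s) / (lam - 1) ^ 2 :=
  integral_abs_kernel_mul_sph_one' hlam hs

omit [BorelSpace Circle] in
/-- **The rank-one identity** `K_λ(t, s) K_λ(t′, s′) = K_λ(t, s′) K_λ(t′, s)` for `t, t′ ≤ s, s′` (row 620). -/
theorem kernel_semi_separable {t t' s s' : ℝ} (hts : t ≤ s) (hts' : t ≤ s') (ht's : t' ≤ s) (ht's' : t' ≤ s') :
    sphGreenKernel lam t s * sphGreenKernel lam t' s' = sphGreenKernel lam t s' * sphGreenKernel lam t' s :=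
  kernel_rank_one lam hts hts' ht's ht's'

omit [BorelSpace Circle] in
/-- **`K_λ(t, t) = −φ_λ(a_t)² T_λ(t)`** (row 620). -/
theorem kernel_diagonal_formula (t : ℝ) :
    sphGreenKernel lam t t = -(sph lam (hyp t) ^ 2 * tailIntegral (fun t => sph lam (hyp t)) t) :=
  kernel_diagonal_eq lam t

include hlam in
/-- **The tail integral decreases** on `(0, ∞)` (row 620). -/
theorem tail_antitone : AntitoneOn (tailIntegral fun t => sph lam (hyp t)) (Ioi 0) :=
  tailIntegral_antitoneOn hlam

include hlam in
/-- **`K_λ(t, s)² ≤ K_λ(t, t) K_λ(s, s)`** (row 620). -/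
theorem kernel_geometric_mean {t s : ℝ} (ht : 0 < t) (hs : 0 < s) :
    sphGreenKernel lam t s ^ 2 ≤ sphGreenKernel lam t t * sphGreenKernel lam s s :=
  abs_kernel_mul_le_diagonal hlam ht hs

include hlam in
/-- **`|K_λ(t, s)| ≤ √(|K_λ(t, t)| |K_λ(s, s)|)`** (row 620). -/
theorem kernel_geometric_mean_sqrt {t s : ℝ} (ht : 0 < t) (hs : 0 < s) :
    |sphGreenKernel lam t s| ≤ Real.sqrt (|sphGreenKernel lam t t| * |sphGreenKernel lam s s|) :=
  abs_kernel_le_sqrt_diagonal hlam ht hs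

include hlam in
/-- **`∫ K_λ(t, r)² sinh 2r dr = (K_λ ∘ K_λ)(t, t)`** (row 621). -/
theorem kernel_row_sq_integral {t : ℝ} (ht : 0 < t) :
    ∫ r in Ioi 0, sphGreenKernel lam t r ^ 2 * Real.sinh (2 * r)
      = greenSolI (fun t => sph lam (hyp t)) (sphDecay lam) (fun r => sphGreenKernel lam r t) t :=
  integral_kernel_sq_eq_comp hlam ht

include hlam in
/-- **The row `K_λ(t, ·)` is square-integrable against `sinh 2r dr`** (row 621). -/
theorem kernel_row_sq_integrable {t : ℝ} (ht : 0 < t) :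
    IntegrableOn (fun r => sphGreenKernel lam t r ^ 2 * Real.sinh (2 * r)) (Ioi 0) :=
  integrableOn_kernel_sq hlam ht

include hlam in
/-- **`∂_μ K_μ(t, t) = ∫ K_λ(t, r)² sinh 2r dr`** (row 621). -/
theorem kernel_diagonal_deriv {t : ℝ} (ht : 0 < t) :
    HasDerivAt (fun μ => sphGreenKernel (1 + Real.sqrt (μ + 1)) t t)
      (∫ r in Ioi 0, sphGreenKernel lam t r ^ 2 * Real.sinh (2 * r)) (lam * (lam - 2)) :=
  hasDerivAt_kernel_diagonal_mu hlam ht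

include hlam in
/-- **`∫ K_λ(t, r)² sinh 2r dr > 0`** (row 621). -/
theorem kernel_row_sq_pos {t : ℝ} (ht : 0 < t) :
    0 < ∫ r in Ioi 0, sphGreenKernel lam t r ^ 2 * Real.sinh (2 * r) :=
  integral_kernel_sq_pos hlam ht

include hlam in
/-- **`K_λ(t, t) sinh 2t → −1/(2(λ − 1))`** as `t → ∞` (row 622). -/
theorem kernel_diagonal_sinh_limit :
    Tendsto (fun t => sphGreenKernel lam t t * Real.sinh (2 * t)) atTop (𝓝 (-(1 / (2 * (lam - 1))))) :=
  tendsto_kernel_diagonal_mul_sinh hlam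

include hlam in
/-- **`K_λ(t, t) → 0`** as `t → ∞` (row 622). -/
theorem kernel_diagonal_limit : Tendsto (fun t => sphGreenKernel lam t t) atTop (𝓝 0) :=
  tendsto_kernel_diagonal_atTop hlam

include hlam in
/-- **The resolvent is not trace class**: `K_λ(t, t) sinh 2t` is not integrable on `(0, ∞)` (row 622). -/
theorem resolvent_not_trace_class :
    ¬ IntegrableOn (fun t => sphGreenKernel lam t t * Real.sinh (2 * t)) (Ioi 0) :=
  not_integrableOn_kernel_diagonal_mul_sinh hlam

end measure

end Summit.Ventures.HodgeRepro2.T5SU11RadialSummaryXXVIII
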